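import Mathlib
import Literature.Analysis.Complex.HolomorphicBanach

/-!
# `Balaban1983to89.B11Ineq189LocalLeaf` — T. Bałaban, *The variational problem and background fields in renormalization group method
# for lattice gauge theories*, Commun. Math. Phys. **102** (1985) 277–309 [Balaban1985Variational], p. 308, the author-omitted second
# differentiation behind (189): THE LOCAL ANALYTIC LEAF — the two-variable Cauchy estimate *«the Cauchy formula (185) applied once
# more»* for the second Fréchet derivative of a quadratic-analytic functional, `‖D²C(X)[u, v]‖ ≤ 9C₂‖u‖‖v‖` on the inner third of the
# ball (the leaf bound U2 of the cell census of (189)), and its first-derivative companion *«with the power of |A| lower by 1»* (p. 291)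

statement-level skeleton of published theorems with citation tags; proofs where landed; nothing here is a claim about the Yang–Mills mass gap

PDF held: `paper:balaban1985-cmp102-variational-background` (journal page = PDF page + 276); p. 308 [PDF 32], p. 291 [PDF 15]; and
T. Bałaban, *Averaging operations for lattice gauge theories*, Commun. Math. Phys. **98** (1985) 17–51 [Balaban1985Averaging], Prop. 4
(134)–(135) p. 38, Prop. 7 p. 43 (`paper:balaban1985-cmp98-averaging`, journal page = PDF page + 16).  Displays taken in the
render-verified transcriptions of record of `B11Ineq189` / `B11Eq185SecondDerivative` / `B7Prop7Ck`.

CITATION HEADER (lean-in-tree rule 2026-08-18).  WHAT IS REPRODUCED: SKELETON row **B11.Eq189** ((189) p. 308, cell GAPS G-B11-G2 KEY: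
the second differentiation of V(A′) is OMITTED IN PRINT — p. 308, verbatim: *«Now we have to differentiate those expressions second time.
We do not perform these calculations here, we have obtained all necessary results to do the calculations and estimates, let us formulate a
final result only»*; tree: `B11Ineq189` (term census over block majorants: every term of (δ²/δA′²)V is a chain of fixed decaying operators
around ONE local bilinear leaf, `B11Ineq189.hasMaj₂_local`, whose hypothesis is the bound «size(T[𝔄]μ) ≤ β·size(μ)·size(𝔄)», and the
located unprinted intermediate δ𝔇 = (δ²/δA′²)D whose leaf is `Φ_c[u, v] = (Lʲη)²∂_s∂_tC_j(X + su + tv)|₀` with *«LEAF BOUND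
|Φ_c[u, v]| ≤ 9C₂|u|_∞|v|_∞»*, cell note `SECOND-DERIVATIVE-189.md` §4 U1–U2).  THIS FILE PROVES THAT LEAF BOUND: the number β = 9C₂ for
every functional that is analytic with |C(Y)| ≤ C₂|Y|² on a ball — the printed hypothesis (134)–(135) of [4] Prop. 4 / Prop. 7 for C_j
(*«|C_k(U₀, A)| ≤ C₂|A|² < C₂α₁². (135)»*, *«the function Q_k(U′U₀, ηA) is analytic in complex variables A′, A»* p. 43) — by the
mechanism the paper itself uses for second derivatives, (185) p. 308: *«((δ²/δA′²)V)(A′)𝔄 = (d/dτ)((δ/δA′)V)(A′ + τ𝔄)|_{τ=0} =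
(1/2πi)∮_{|τ|=r} (dτ/τ²)((δ/δA′)V)(A′ + τ𝔄) (185)»*, applied in two complex variables; and the first-derivative companion of p. 291:
*«The derivative ((∂/∂A(b))V₀′)(A, ∂p) satisfies a bound similar to the bound (40) for the function V₀′(A, ∂p), but with the power of |A|
lower by 1, and with a different absolute constant.»*

WHAT IS CERTIFIED (kernel, sorry-free; standard axioms; theorems only).  Over a complex normed space `𝒴 ∋ X, u, v` and a complex Banach
space `F` (the tree's `Literature.Analysis.Complex.SCV.norm_fderiv_apply_le` = Cauchy's inequality for a directional derivative, and
`HolomorphicBanach.fderiv_fderiv_apply` = «D²f(x) h v = ∂_h∂_v f(x)», BY NAME):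
§1 **`norm_fderiv_fderiv_apply_le_of_bound`** — THE TWO-VARIABLE CAUCHY ESTIMATE: if `f` is complex-differentiable on an open `U`
   containing the closed complex bidisc `{X + su + tv : |s| ≤ r, |t| ≤ r′}` and `‖f‖ ≤ M` there, then `‖∂_u∂_v f(X)‖ ≤ M/(r·r′)` (Cauchy's
   inequality in `t` at every point `X + su` of the `s`-disc, then in `s` for the holomorphic function `s ↦ ∂_v f(X + su)`);
   `norm_fderiv_fderiv_le_of_bound` (the same for `D²f(X) u v`).
§2 **`norm_d2_le_of_quad`** — THE LEAF BOUND U2: `C` complex-differentiable on the ball `‖Y‖ < R` with `‖C(Y)‖ ≤ C₂‖Y‖²` there and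
   `‖X‖ < R/3` ⟹ `‖∂_u∂_v C(X)‖ ≤ 9C₂‖u‖‖v‖` (radii `R/(3‖u‖)`, `R/(3‖v‖)`: the bidisc stays in the ball, where `‖C‖ ≤ C₂R²`);
   `norm_fderiv_fderiv_quad_le` (for `D²C(X) u v`), **`opNorm_fderiv_fderiv_quad_le`** (`‖D²C(X)‖ ≤ 9C₂` as a bilinear operator).
§3 **`norm_d1_le_of_quad`** — «the power of |A| lower by 1»: under the same hypotheses, for `2‖X‖ < R`, `‖∂_v C(X)‖ ≤ 4C₂‖X‖‖v‖`
   (radius `‖X‖/‖v‖`, the printed radius of (185)–(186); at `X = 0` the derivative vanishes).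
§4 (appended 2026-08-26) **`norm_d2_le_of_sup_bound`** / `norm_fderiv_fderiv_le_of_sup_bound` / `opNorm_fderiv_fderiv_le_of_sup_bound` —
   «the power of |A| lower by 2»: a SUP bound `‖C‖ ≤ M` on the ball `‖Y‖ < R` gives `‖D²C(X)[u, v]‖ ≤ (9M/R²)‖u‖‖v‖` for `‖X‖ < R/3` (the
   mechanism for the non-quadratic local leaves: V₀′(A, ∂p) of (39)–(40), the cubic P_α of p. 292 — census U2(ii)–(iii)).
§5 (appended 2026-08-26) `norm_d2_multilinear_diag_le` / `norm_fderiv_fderiv_multilinear_diag_le` — the homogeneous-polynomial leaf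
   `f(Y) = P(Y, …, Y)`: `‖D²f(X)[u, v]‖ ≤ 9‖P‖Rⁿ⁻²‖u‖‖v‖` for `3‖X‖ < R` (census U2(iii), the cubic local polynomials of p. 292).

HONEST SCOPE.  A norm-level leaf: the functional `C` is abstract (any quadratic-analytic functional on a ball of a complex normed space);
its instantiation for Bałaban's `C_j(U₀, ·)` on the insertion spaces of [4] is `B7Prop7Ck.prop7_Ck_ins` + the bound of
`B7Prop7Levels.prop7_prop4_uniform` (not repeated here), and the LOCALITY that turns the norm bound into the block form `hloc` of
`B11Ineq189.hasMaj₂_local` (C = Σ_c C_c, C_c a function of the variables on B(c)) is structural.  Nothing else of the (189) census is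
touched; (189) itself stays a located leaf (GAPS G-B11-G2).  Seat pub-ymgap-dag-n07-b (HUMAN RULING D-0062, node N07 [B11]; «MISSING
ESTIMATE N07: (189) p. 308, leaf U2»).  Imports `Literature.Analysis.Complex.HolomorphicBanach` (tree, [Chae1985]) and Mathlib; no new
definition, no new named fact.
-/

noncomputable section

namespace Literature.MathematicalPhysics.QuantumFieldTheory.Balaban1983to89.B11Ineq189LocalLeaf

open Set Metric
open Literature.Analysis.Complex Literature.Analysis.Complex.SCV Literature.Analysis.Complex.HolomorphicBanach

variable {𝒴 : Type*} [NormedAddCommGroup 𝒴] [NormedSpace ℂ 𝒴] {F : Type*} [NormedAddCommGroup F] [NormedSpace ℂ F]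
  [CompleteSpace F]

/-! ## §1 The two-variable Cauchy estimate for the mixed second derivative -/

/-- **Cauchy's inequality in two complex variables** (the Cauchy formula (185) applied once more, as the omitted computation of p. 308
requires for every local analytic leaf): if `f` is complex-differentiable on an open set `U` containing the closed bidisc
`{X + s•u + t•v : |s| ≤ r, |t| ≤ r′}` and `‖f‖ ≤ M` on that bidisc, then the mixed second directional derivative satisfies
`‖∂_u ∂_v f(X)‖ ≤ M/(r·r′)` — Cauchy's inequality in `t` (`SCV.norm_fderiv_apply_le`) at every point `X + s•u`, `|s| ≤ r`, bounds the
holomorphic function `s ↦ ∂_v f(X + s•u)` by `M/r′` on the `s`-disc, and Cauchy's inequality in `s` concludes.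
[cite: Balaban1985Variational, (185) p.308] -/
theorem norm_fderiv_fderiv_apply_le_of_bound {f : 𝒴 → F} {U : Set 𝒴} (hf : DifferentiableOn ℂ f U) (hU : IsOpen U)
    {X u v : 𝒴} {r r' M : ℝ} (hr : 0 < r) (hr' : 0 < r')
    (hsub : ∀ s ∈ closedBall (0 : ℂ) r, ∀ t ∈ closedBall (0 : ℂ) r', X + s • u + t • v ∈ U)
    (hM : ∀ s ∈ closedBall (0 : ℂ) r, ∀ t ∈ closedBall (0 : ℂ) r', ‖f (X + s • u + t • v)‖ ≤ M) :
    ‖fderiv ℂ (fun Y => fderiv ℂ f Y v) X u‖ ≤ M / (r * r') := by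
  -- Cauchy in `t` at every point `X + s•u` of the closed `s`-disc
  have hinner : ∀ s ∈ closedBall (0 : ℂ) r, ‖fderiv ℂ f (X + s • u) v‖ ≤ M / r' := by
    intro s hs
    exact norm_fderiv_apply_le hf hU hr' (fun t ht => hsub s hs t ht) (fun t ht => hM s hs t (sphere_subset_closedBall ht))
  -- `Y ↦ ∂_v f(Y)` is holomorphic on `U`; Cauchy in `s`
  have hg : DifferentiableOn ℂ (fun Y => fderiv ℂ f Y v) U := differentiableOn_fderiv_apply hf hU v
  have hsub' : ∀ s ∈ closedBall (0 : ℂ) r, X + s • u ∈ U := by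
    intro s hs
    have h := hsub s hs 0 (mem_closedBall_self hr'.le)
    simpa using h
  have key := norm_fderiv_apply_le hg hU hr hsub' (C := M / r') (fun s hs => hinner s (sphere_subset_closedBall hs))
  calc ‖fderiv ℂ (fun Y => fderiv ℂ f Y v) X u‖ ≤ M / r' / r := key
    _ = M / (r * r') := by rw [div_div, mul_comm]

/-- The same for the second Fréchet derivative: `‖D²f(X) u v‖ ≤ M/(r·r′)` (`HolomorphicBanach.fderiv_fderiv_apply`:
D²f(X) u v = ∂_u∂_v f(X)). [cite: Balaban1985Variational, (185) p.308] -/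
theorem norm_fderiv_fderiv_le_of_bound {f : 𝒴 → F} {U : Set 𝒴} (hf : DifferentiableOn ℂ f U) (hU : IsOpen U)
    {X u v : 𝒴} {r r' M : ℝ} (hr : 0 < r) (hr' : 0 < r')
    (hsub : ∀ s ∈ closedBall (0 : ℂ) r, ∀ t ∈ closedBall (0 : ℂ) r', X + s • u + t • v ∈ U)
    (hM : ∀ s ∈ closedBall (0 : ℂ) r, ∀ t ∈ closedBall (0 : ℂ) r', ‖f (X + s • u + t • v)‖ ≤ M) :
    ‖fderiv ℂ (fderiv ℂ f) X u v‖ ≤ M / (r * r') := by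
  have hX : X ∈ U := by
    have h := hsub 0 (mem_closedBall_self hr.le) 0 (mem_closedBall_self hr'.le)
    simpa using h
  rw [fderiv_fderiv_apply hf hU hX u v]
  exact norm_fderiv_fderiv_apply_le_of_bound hf hU hr hr' hsub hM

/-! ## §2 The leaf bound for a quadratic-analytic functional: `‖D²C(X)[u, v]‖ ≤ 9C₂‖u‖‖v‖` -/

section Quad

variable {C : 𝒴 → F} {R C₂ : ℝ}

/-- Points of the bidisc of radii `R/(3‖u‖)`, `R/(3‖v‖)` around a centre `X` with `‖X‖ < R/3` lie in the ball of radius `R`.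
[folklore] -/
private theorem bidisc_mem_ball {X u v : 𝒴} (hX : ‖X‖ < R / 3) (hu : u ≠ 0) (hv : v ≠ 0) {s t : ℂ}
    (hs : s ∈ closedBall (0 : ℂ) (R / (3 * ‖u‖))) (ht : t ∈ closedBall (0 : ℂ) (R / (3 * ‖v‖))) :
    ‖X + s • u + t • v‖ < R := by
  have hu0 : 0 < ‖u‖ := norm_pos_iff.mpr hu
  have hv0 : 0 < ‖v‖ := norm_pos_iff.mpr hv
  rw [mem_closedBall, dist_zero_right] at hs ht
  have h1 : ‖s • u‖ ≤ R / 3 := by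
    rw [norm_smul]
    calc ‖s‖ * ‖u‖ ≤ R / (3 * ‖u‖) * ‖u‖ := mul_le_mul_of_nonneg_right hs hu0.le
      _ = R / 3 := by field_simp
  have h2 : ‖t • v‖ ≤ R / 3 := by
    rw [norm_smul]
    calc ‖t‖ * ‖v‖ ≤ R / (3 * ‖v‖) * ‖v‖ := mul_le_mul_of_nonneg_right ht hv0.le
      _ = R / 3 := by field_simp
  calc ‖X + s • u + t • v‖ ≤ ‖X + s • u‖ + ‖t • v‖ := norm_add_le _ _
    _ ≤ ‖X‖ + ‖s • u‖ + ‖t • v‖ := by linarith [norm_add_le X (s • u)]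
    _ < R := by linarith

/-- **THE LEAF BOUND U2 of the (189) census** — for a functional `C` complex-differentiable on the ball `‖Y‖ < R` with the quadratic bound
`‖C(Y)‖ ≤ C₂‖Y‖²` there ([4] Prop. 4 (135) for `C_j(U₀, ·)`: *«|C_k(U₀, A)| ≤ C₂|A|² < C₂α₁²»*, analytic by [4] Prop. 7) and a centre with
`‖X‖ < R/3`: `‖∂_u ∂_v C(X)‖ ≤ 9C₂‖u‖‖v‖` — §1 on the bidisc of radii `R/(3‖u‖)`, `R/(3‖v‖)` (inside the ball, where `‖C‖ ≤ C₂R²`), so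
that `M/(r r′) = C₂R²·9‖u‖‖v‖/R²`; the directions `u = 0` or `v = 0` give `0`. [cite: Balaban1985Variational, (189) p.308]
[cite: Balaban1985Averaging, Prop. 4 (134)–(135) p.38] -/
theorem norm_d2_le_of_quad (hC : DifferentiableOn ℂ C (ball (0 : 𝒴) R)) (hC₂ : 0 ≤ C₂)
    (hquad : ∀ Y : 𝒴, ‖Y‖ < R → ‖C Y‖ ≤ C₂ * ‖Y‖ ^ 2) {X : 𝒴} (hX : ‖X‖ < R / 3) (u v : 𝒴) :
    ‖fderiv ℂ (fun Y => fderiv ℂ C Y v) X u‖ ≤ 9 * C₂ * ‖u‖ * ‖v‖ := by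
  have hR : 0 < R := by linarith [norm_nonneg X]
  have hXball : X ∈ ball (0 : 𝒴) R := by rw [mem_ball_zero_iff]; linarith
  -- degenerate directions
  by_cases hv : v = 0
  · subst hv
    have : (fun Y => fderiv ℂ C Y (0 : 𝒴)) = fun _ => (0 : F) := by funext Y; simp
    rw [this]; simp
  by_cases hu : u = 0
  · subst hu; simp
  have hu0 : 0 < ‖u‖ := norm_pos_iff.mpr hu
  have hv0 : 0 < ‖v‖ := norm_pos_iff.mpr hv
  have hr : 0 < R / (3 * ‖u‖) := by positivity
  have hr' : 0 < R / (3 * ‖v‖) := by positivity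
  have hsub : ∀ s ∈ closedBall (0 : ℂ) (R / (3 * ‖u‖)), ∀ t ∈ closedBall (0 : ℂ) (R / (3 * ‖v‖)),
      X + s • u + t • v ∈ ball (0 : 𝒴) R := fun s hs t ht => by
    rw [mem_ball_zero_iff]; exact bidisc_mem_ball hX hu hv hs ht
  have hM : ∀ s ∈ closedBall (0 : ℂ) (R / (3 * ‖u‖)), ∀ t ∈ closedBall (0 : ℂ) (R / (3 * ‖v‖)),
      ‖C (X + s • u + t • v)‖ ≤ C₂ * R ^ 2 := fun s hs t ht => by
    have hlt := bidisc_mem_ball hX hu hv hs ht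
    have hn : 0 ≤ ‖X + s • u + t • v‖ := norm_nonneg _
    calc ‖C (X + s • u + t • v)‖ ≤ C₂ * ‖X + s • u + t • v‖ ^ 2 := hquad _ hlt
      _ ≤ C₂ * R ^ 2 := by
          refine mul_le_mul_of_nonneg_left ?_ hC₂
          exact pow_le_pow_left₀ hn hlt.le 2
  have key := norm_fderiv_fderiv_apply_le_of_bound hC isOpen_ball hr hr' hsub hM
  have e : C₂ * R ^ 2 / (R / (3 * ‖u‖) * (R / (3 * ‖v‖))) = 9 * C₂ * ‖u‖ * ‖v‖ := by
    field_simp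
    ring
  rw [e] at key
  exact key

/-- The leaf bound for the second Fréchet derivative: `‖D²C(X) u v‖ ≤ 9C₂‖u‖‖v‖` for `‖X‖ < R/3`.
[cite: Balaban1985Variational, (189) p.308] [cite: Balaban1985Averaging, Prop. 4 (134)–(135) p.38] -/
theorem norm_fderiv_fderiv_quad_le (hC : DifferentiableOn ℂ C (ball (0 : 𝒴) R)) (hC₂ : 0 ≤ C₂)
    (hquad : ∀ Y : 𝒴, ‖Y‖ < R → ‖C Y‖ ≤ C₂ * ‖Y‖ ^ 2) {X : 𝒴} (hX : ‖X‖ < R / 3) (u v : 𝒴) :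
    ‖fderiv ℂ (fderiv ℂ C) X u v‖ ≤ 9 * C₂ * ‖u‖ * ‖v‖ := by
  have hXball : X ∈ ball (0 : 𝒴) R := by rw [mem_ball_zero_iff]; linarith [norm_nonneg X]
  rw [fderiv_fderiv_apply hC isOpen_ball hXball u v]
  exact norm_d2_le_of_quad hC hC₂ hquad hX u v

/-- **The leaf bound in operator norm**: `‖D²C(X)‖ ≤ 9C₂` on the inner third of the ball — the number β of `B11Ineq189.hasMaj₂_local` for a
quadratic-analytic local functional, independent of the centre (no ε, as recorded in the census: *«LOCAL, no ε»*).
[cite: Balaban1985Variational, (189) p.308] [cite: Balaban1985Averaging, Prop. 4 (134)–(135) p.38] -/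
theorem opNorm_fderiv_fderiv_quad_le (hC : DifferentiableOn ℂ C (ball (0 : 𝒴) R)) (hC₂ : 0 ≤ C₂)
    (hquad : ∀ Y : 𝒴, ‖Y‖ < R → ‖C Y‖ ≤ C₂ * ‖Y‖ ^ 2) {X : 𝒴} (hX : ‖X‖ < R / 3) :
    ‖fderiv ℂ (fderiv ℂ C) X‖ ≤ 9 * C₂ := by
  refine ContinuousLinearMap.opNorm_le_bound _ (by positivity) fun u => ?_
  refine ContinuousLinearMap.opNorm_le_bound _ (by positivity) fun v => ?_
  calc ‖fderiv ℂ (fderiv ℂ C) X u v‖ ≤ 9 * C₂ * ‖u‖ * ‖v‖ := norm_fderiv_fderiv_quad_le hC hC₂ hquad hX u v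
    _ = 9 * C₂ * ‖u‖ * ‖v‖ := rfl

/-! ## §3 «with the power of |A| lower by 1»: the first derivative of a quadratic-analytic functional -/

omit [CompleteSpace F] in
/-- **p. 291's mechanism**: for `C` complex-differentiable on `‖Y‖ < R` with `‖C(Y)‖ ≤ C₂‖Y‖²`, at a centre with `2‖X‖ < R`:
`‖∂_v C(X)‖ ≤ 4C₂‖X‖‖v‖` — Cauchy's inequality on the circle of THE PRINTED radius `r = ‖X‖/‖v‖` of (185)–(186), on which the argument has
size ≤ 2‖X‖ and hence `‖C‖ ≤ C₂(2‖X‖)² = 4C₂‖X‖²`; at `X = 0` the derivative vanishes (C is of second order).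
[cite: Balaban1985Variational, p.291 + (185)–(186) p.308] [cite: Balaban1985Averaging, Prop. 4 (135) p.38] -/
theorem norm_d1_le_of_quad (hC : DifferentiableOn ℂ C (ball (0 : 𝒴) R)) (hC₂ : 0 ≤ C₂)
    (hquad : ∀ Y : 𝒴, ‖Y‖ < R → ‖C Y‖ ≤ C₂ * ‖Y‖ ^ 2) {X : 𝒴} (hX : 2 * ‖X‖ < R) (v : 𝒴) :
    ‖fderiv ℂ C X v‖ ≤ 4 * C₂ * ‖X‖ * ‖v‖ := by
  have hR : 0 < R := by linarith [norm_nonneg X]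
  have hXball : X ∈ ball (0 : 𝒴) R := by rw [mem_ball_zero_iff]; linarith [norm_nonneg X]
  by_cases hv : v = 0
  · subst hv; simp
  have hv0 : 0 < ‖v‖ := norm_pos_iff.mpr hv
  by_cases hX0 : X = 0
  · -- C is of second order at 0: its derivative there vanishes
    subst hX0
    have hC0 : C 0 = 0 := by
      have := hquad 0 (by simpa using hR)
      simpa using this
    have hderiv : HasFDerivAt C (0 : 𝒴 →L[ℂ] F) 0 := by
      rw [hasFDerivAt_iff_isLittleO_nhds_zero]
      refine Asymptotics.IsLittleO.of_bound fun ε hε => ?_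
      have hδ : 0 < min R (ε / (C₂ + 1)) := lt_min hR (by positivity)
      filter_upwards [ball_mem_nhds (0 : 𝒴) hδ] with h hh
      rw [mem_ball_zero_iff, lt_min_iff] at hh
      rw [zero_add, hC0, sub_zero, show ((0 : 𝒴 →L[ℂ] F) h) = 0 from rfl, sub_zero]
      calc ‖C h‖ ≤ C₂ * ‖h‖ ^ 2 := hquad h hh.1
        _ = (C₂ * ‖h‖) * ‖h‖ := by ring
        _ ≤ ε * ‖h‖ := by
            refine mul_le_mul_of_nonneg_right ?_ (norm_nonneg _)
            have h1 : C₂ * ‖h‖ ≤ C₂ * (ε / (C₂ + 1)) := mul_le_mul_of_nonneg_left hh.2.le hC₂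
            have h2 : C₂ * (ε / (C₂ + 1)) ≤ ε := by
              rw [mul_div_assoc']
              exact (div_le_iff₀ (by linarith)).mpr (by nlinarith)
            linarith
    rw [hderiv.fderiv]; simp
  have hXn : 0 < ‖X‖ := norm_pos_iff.mpr hX0
  have hr : 0 < ‖X‖ / ‖v‖ := div_pos hXn hv0
  -- on the printed circle the argument has size ≤ 2‖X‖ < R
  have hsize : ∀ t ∈ closedBall (0 : ℂ) (‖X‖ / ‖v‖), ‖X + t • v‖ ≤ 2 * ‖X‖ := fun t ht => by
    rw [mem_closedBall, dist_zero_right] at ht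
    have : ‖t • v‖ ≤ ‖X‖ := by
      rw [norm_smul]
      calc ‖t‖ * ‖v‖ ≤ ‖X‖ / ‖v‖ * ‖v‖ := mul_le_mul_of_nonneg_right ht hv0.le
        _ = ‖X‖ := by field_simp
    linarith [norm_add_le X (t • v)]
  have hsub : ∀ t ∈ closedBall (0 : ℂ) (‖X‖ / ‖v‖), X + t • v ∈ ball (0 : 𝒴) R := fun t ht => by
    rw [mem_ball_zero_iff]; linarith [hsize t ht]
  have hM : ∀ t ∈ sphere (0 : ℂ) (‖X‖ / ‖v‖), ‖C (X + t • v)‖ ≤ 4 * C₂ * ‖X‖ ^ 2 := fun t ht => by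
    have ht' := sphere_subset_closedBall ht
    have hlt : ‖X + t • v‖ < R := by linarith [hsize t ht']
    calc ‖C (X + t • v)‖ ≤ C₂ * ‖X + t • v‖ ^ 2 := hquad _ hlt
      _ ≤ C₂ * (2 * ‖X‖) ^ 2 :=
          mul_le_mul_of_nonneg_left (pow_le_pow_left₀ (norm_nonneg _) (hsize t ht') 2) hC₂
      _ = 4 * C₂ * ‖X‖ ^ 2 := by ring
  have key := norm_fderiv_apply_le hC isOpen_ball hr hsub hM
  calc ‖fderiv ℂ C X v‖ ≤ 4 * C₂ * ‖X‖ ^ 2 / (‖X‖ / ‖v‖) := key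
    _ = 4 * C₂ * ‖X‖ * ‖v‖ := by field_simp

end Quad

/-! ## §4 «with the power of |A| lower by 2»: a sup bound on a ball bounds the second derivative on the inner third -/

section SupBound

variable {C : 𝒴 → F} {R M : ℝ}

/-- **The mechanism for the non-quadratic leaves** (the boundary terms V₀′(A, ∂p) of (39)–(40) and the cubic polynomials P_α of p. 292, census
U2(ii)–(iii)): if `C` is complex-differentiable on the ball `‖Y‖ < R` with the SUP bound `‖C(Y)‖ ≤ M` there, then for `‖X‖ < R/3`,
`‖∂_u∂_v C(X)‖ ≤ (9M/R²)·‖u‖‖v‖` — §1 on the bidisc of radii `R/(3‖u‖)`, `R/(3‖v‖)`; «the power of |A| lower by 2» (p. 291's remark iterated):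
a bound `M(R)` of order `R^m` yields a second derivative of order `R^{m−2}`. [cite: Balaban1985Variational, p.291 + (185) p.308, (39)–(40) p.284] -/
theorem norm_d2_le_of_sup_bound (hC : DifferentiableOn ℂ C (ball (0 : 𝒴) R))
    (hsup : ∀ Y : 𝒴, ‖Y‖ < R → ‖C Y‖ ≤ M) {X : 𝒴} (hX : ‖X‖ < R / 3) (u v : 𝒴) :
    ‖fderiv ℂ (fun Y => fderiv ℂ C Y v) X u‖ ≤ 9 * M / R ^ 2 * ‖u‖ * ‖v‖ := by
  have hR : 0 < R := by linarith [norm_nonneg X]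
  by_cases hv : v = 0
  · subst hv
    have : (fun Y => fderiv ℂ C Y (0 : 𝒴)) = fun _ => (0 : F) := by funext Y; simp
    rw [this]; simp
  by_cases hu : u = 0
  · subst hu; simp
  have hu0 : 0 < ‖u‖ := norm_pos_iff.mpr hu
  have hv0 : 0 < ‖v‖ := norm_pos_iff.mpr hv
  have hr : 0 < R / (3 * ‖u‖) := by positivity
  have hr' : 0 < R / (3 * ‖v‖) := by positivity
  have hsub : ∀ s ∈ closedBall (0 : ℂ) (R / (3 * ‖u‖)), ∀ t ∈ closedBall (0 : ℂ) (R / (3 * ‖v‖)),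
      X + s • u + t • v ∈ ball (0 : 𝒴) R := fun s hs t ht => by
    rw [mem_ball_zero_iff]; exact bidisc_mem_ball hX hu hv hs ht
  have hMb : ∀ s ∈ closedBall (0 : ℂ) (R / (3 * ‖u‖)), ∀ t ∈ closedBall (0 : ℂ) (R / (3 * ‖v‖)),
      ‖C (X + s • u + t • v)‖ ≤ M := fun s hs t ht => hsup _ (bidisc_mem_ball hX hu hv hs ht)
  have key := norm_fderiv_fderiv_apply_le_of_bound hC isOpen_ball hr hr' hsub hMb
  have e : M / (R / (3 * ‖u‖) * (R / (3 * ‖v‖))) = 9 * M / R ^ 2 * ‖u‖ * ‖v‖ := by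
    field_simp
    ring
  rw [e] at key
  exact key

/-- The same for the second Fréchet derivative: `‖D²C(X) u v‖ ≤ (9M/R²)‖u‖‖v‖` for `‖X‖ < R/3`.
[cite: Balaban1985Variational, p.291 + (185) p.308, (39)–(40) p.284] -/
theorem norm_fderiv_fderiv_le_of_sup_bound (hC : DifferentiableOn ℂ C (ball (0 : 𝒴) R))
    (hsup : ∀ Y : 𝒴, ‖Y‖ < R → ‖C Y‖ ≤ M) {X : 𝒴} (hX : ‖X‖ < R / 3) (u v : 𝒴) :
    ‖fderiv ℂ (fderiv ℂ C) X u v‖ ≤ 9 * M / R ^ 2 * ‖u‖ * ‖v‖ := by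
  have hXball : X ∈ ball (0 : 𝒴) R := by rw [mem_ball_zero_iff]; linarith [norm_nonneg X]
  rw [fderiv_fderiv_apply hC isOpen_ball hXball u v]
  exact norm_d2_le_of_sup_bound hC hsup hX u v

/-- **Operator-norm form**: `‖D²C(X)‖ ≤ 9M/R²` on the inner third of the ball. [cite: Balaban1985Variational, p.291 + (185) p.308] -/
theorem opNorm_fderiv_fderiv_le_of_sup_bound (hC : DifferentiableOn ℂ C (ball (0 : 𝒴) R)) (hM : 0 ≤ M)
    (hsup : ∀ Y : 𝒴, ‖Y‖ < R → ‖C Y‖ ≤ M) {X : 𝒴} (hX : ‖X‖ < R / 3) :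
    ‖fderiv ℂ (fderiv ℂ C) X‖ ≤ 9 * M / R ^ 2 := by
  have hR : 0 < R := by linarith [norm_nonneg X]
  refine ContinuousLinearMap.opNorm_le_bound _ (by positivity) fun u => ?_
  refine ContinuousLinearMap.opNorm_le_bound _ (by positivity) fun v => ?_
  calc ‖fderiv ℂ (fderiv ℂ C) X u v‖ ≤ 9 * M / R ^ 2 * ‖u‖ * ‖v‖ := norm_fderiv_fderiv_le_of_sup_bound hC hsup hX u v
    _ = 9 * M / R ^ 2 * ‖u‖ * ‖v‖ := rfl

end SupBound

/-! ## §5 The local polynomial leaves: homogeneous polynomials (the cubic commutator terms of p. 292) -/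

section Polynomial

variable {ι : Type*} [Fintype ι]

/-- **The homogeneous-polynomial leaf** (census U2(iii): the cubic LOCAL polynomials `P_α(A′, DA′, A″)` of p. 292, *«estimated easily by
O(1)|DA′||A′|»* with one factor replaced by the direction): for a continuous multilinear form `P` of degree `n = |ι|` and `f(Y) := P(Y, …, Y)`,
on a ball of radius `R > 3‖X‖`: `‖∂_u∂_v f(X)‖ ≤ 9·‖P‖Rⁿ/R²·‖u‖‖v‖` (§4 with the sup bound `‖P(Y, …, Y)‖ ≤ ‖P‖‖Y‖ⁿ ≤ ‖P‖Rⁿ`); for the cubic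
terms (`n = 3`) this is `9‖P‖R‖u‖‖v‖ = O(1)·|A′|·|u||v|`. [cite: Balaban1985Variational, (91)–(96) p.292, (189) p.308] -/
theorem norm_d2_multilinear_diag_le (P : ContinuousMultilinearMap ℂ (fun _ : ι => 𝒴) F) {X : 𝒴} {R : ℝ} (hX : ‖X‖ < R / 3)
    (u v : 𝒴) :
    ‖fderiv ℂ (fun Y => fderiv ℂ (fun Z : 𝒴 => P (fun _ => Z)) Y v) X u‖ ≤
      9 * (‖P‖ * R ^ Fintype.card ι) / R ^ 2 * ‖u‖ * ‖v‖ := by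
  have hR : 0 < R := by linarith [norm_nonneg X]
  have hcd : ContDiff ℂ 1 (fun Z : 𝒴 => P (fun _ : ι => Z)) :=
    (ContinuousMultilinearMap.contDiff P).comp (contDiff_pi.2 fun _ => contDiff_id)
  have hC : DifferentiableOn ℂ (fun Z : 𝒴 => P (fun _ : ι => Z)) (ball (0 : 𝒴) R) :=
    (hcd.differentiable one_ne_zero).differentiableOn
  have hsup : ∀ Y : 𝒴, ‖Y‖ < R → ‖P (fun _ : ι => Y)‖ ≤ ‖P‖ * R ^ Fintype.card ι := fun Y hY => by
    calc ‖P (fun _ : ι => Y)‖ ≤ ‖P‖ * ∏ _i : ι, ‖Y‖ := P.le_opNorm _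
      _ = ‖P‖ * ‖Y‖ ^ Fintype.card ι := by rw [Finset.prod_const, Finset.card_univ]
      _ ≤ ‖P‖ * R ^ Fintype.card ι :=
          mul_le_mul_of_nonneg_left (pow_le_pow_left₀ (norm_nonneg Y) hY.le _) (norm_nonneg P)
  exact norm_d2_le_of_sup_bound hC hsup hX u v

/-- The same for the second Fréchet derivative of the homogeneous polynomial. [cite: Balaban1985Variational, (91)–(96) p.292, (189) p.308] -/
theorem norm_fderiv_fderiv_multilinear_diag_le (P : ContinuousMultilinearMap ℂ (fun _ : ι => 𝒴) F) {X : 𝒴} {R : ℝ}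
    (hX : ‖X‖ < R / 3) (u v : 𝒴) :
    ‖fderiv ℂ (fderiv ℂ (fun Z : 𝒴 => P (fun _ => Z))) X u v‖ ≤ 9 * (‖P‖ * R ^ Fintype.card ι) / R ^ 2 * ‖u‖ * ‖v‖ := by
  have hR : 0 < R := by linarith [norm_nonneg X]
  have hcd : ContDiff ℂ 1 (fun Z : 𝒴 => P (fun _ : ι => Z)) :=
    (ContinuousMultilinearMap.contDiff P).comp (contDiff_pi.2 fun _ => contDiff_id)
  have hC : DifferentiableOn ℂ (fun Z : 𝒴 => P (fun _ : ι => Z)) (ball (0 : 𝒴) R) :=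
    (hcd.differentiable one_ne_zero).differentiableOn
  have hXball : X ∈ ball (0 : 𝒴) R := by rw [mem_ball_zero_iff]; linarith [norm_nonneg X]
  rw [fderiv_fderiv_apply hC isOpen_ball hXball u v]
  exact norm_d2_multilinear_diag_le P hX u v

end Polynomial

end Literature.MathematicalPhysics.QuantumFieldTheory.Balaban1983to89.B11Ineq189LocalLeaf

end
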